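import Summits.NavierStokesRegularity.OSWSelfSimilar.SheetRowThirdExactFamily
import HarnessLib

/-!
# Three elementary integrals on `(0, ∞)` and the decay of the double-pole profile (calculus tools)

Support file (one-variable calculus only; no model content) for `GCLMGaugeAOriginRates`: the integrals
`∫_{t>0} (1+t²)⁻² dt = π/4`, `∫_{t>0} (1+t²)⁻³ dt = 3π/16`, `∫_{t>0} (1+t²)⁻⁴ dt = 5π/32` from explicit arctangent-plus-rational
primitives, their linear combinations, and `∫_{t>0} f′ = 0` for the double-pole test profile `f(x) = x/(1+x²)²` of
`SheetRowThirdExactFamily` (`f′` integrable, `f → 0`). All statements are classical calculus. [folklore]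
WHAT THIS IS NOT: not NS — no equation appears here.
-/

namespace Summit.NavierStokesRegularity.OSWSelfSimilar
namespace GCLMGaugeAOriginRates

open _root_.MeasureTheory Set Filter
open scoped Real Topology
open SheetRowThirdExactFamily

/-! ### Three elementary integrals on `(0, ∞)` -/

/-- `t/(1+t²)^k`-type terms vanish at `+∞`: `t/(1+t²) → 0`. [folklore] -/
private theorem tendsto_div_one_add_sq : Tendsto (fun t : ℝ => t / (1 + t ^ 2)) atTop (𝓝 0) := by
  refine squeeze_zero_norm' ?_ tendsto_inv_atTop_zero
  filter_upwards [eventually_gt_atTop (0 : ℝ)] with t ht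
  rw [Real.norm_eq_abs, abs_of_nonneg (div_nonneg ht.le (by positivity)), div_le_iff₀ (by positivity),
    inv_mul_eq_div, le_div_iff₀ ht]
  nlinarith [sq_nonneg t]

/-- `1/(1+t²) → 0` at `+∞`. [folklore] -/
private theorem tendsto_inv_one_add_sq : Tendsto (fun t : ℝ => (1 + t ^ 2)⁻¹) atTop (𝓝 0) := by
  refine tendsto_inv_atTop_zero.comp ?_
  exact tendsto_atTop_add_const_left atTop 1 (tendsto_pow_atTop two_ne_zero)

/-- Primitive of `(1+t²)⁻²`: `P₂(t) = t/(2(1+t²)) + (1/2) arctan t`. [folklore] -/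
private theorem hasDerivAt_prim2 (t : ℝ) :
    HasDerivAt (fun s : ℝ => s / (2 * (1 + s ^ 2)) + 1 / 2 * Real.arctan s) (1 / (1 + t ^ 2) ^ 2) t := by
  have hD : (1 + t ^ 2) ≠ 0 := by positivity
  have hden : HasDerivAt (fun s : ℝ => 2 * (1 + s ^ 2)) (2 * (2 * t)) t := (hasDerivAt_one_add_sq t).const_mul 2
  have h1 := (hasDerivAt_id' t).div hden (by positivity)
  have h2 := (Real.hasDerivAt_arctan t).const_mul (1 / 2)
  refine (h1.add h2).congr_deriv ?_
  field_simp
  ring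

/-- Primitive of `(1+t²)⁻³`: `P₃(t) = t(3t²+5)/(8(1+t²)²) + (3/8) arctan t`. [folklore] -/
private theorem hasDerivAt_prim3 (t : ℝ) :
    HasDerivAt (fun s : ℝ => s * (3 * s ^ 2 + 5) / (8 * (1 + s ^ 2) ^ 2) + 3 / 8 * Real.arctan s)
      (1 / (1 + t ^ 2) ^ 3) t := by
  have hD : (1 + t ^ 2) ≠ 0 := by positivity
  have hnum : HasDerivAt (fun s : ℝ => s * (3 * s ^ 2 + 5)) (1 * (3 * t ^ 2 + 5) + t * (3 * (2 * t))) t := by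
    have h2 : HasDerivAt (fun s : ℝ => 3 * s ^ 2 + 5) (3 * (2 * t)) t := by
      simpa using (((hasDerivAt_id' t).pow 2).const_mul 3).add_const 5
    have := (hasDerivAt_id' t).mul h2
    refine this.congr_deriv ?_
    rfl
  have hden : HasDerivAt (fun s : ℝ => 8 * (1 + s ^ 2) ^ 2) (8 * (2 * (1 + t ^ 2) * (2 * t))) t := by
    have := ((hasDerivAt_one_add_sq t).pow 2).const_mul 8
    refine this.congr_deriv ?_
    ring
  have h1 := hnum.div hden (by positivity)
  have h2 := (Real.hasDerivAt_arctan t).const_mul (3 / 8)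
  refine (h1.add h2).congr_deriv ?_
  field_simp
  ring

/-- Primitive of `(1+t²)⁻⁴`: `P₄(t) = t/(6(1+t²)³) + 5t(3t²+5)/(48(1+t²)²) + (5/16) arctan t`. [folklore] -/
private theorem hasDerivAt_prim4 (t : ℝ) :
    HasDerivAt (fun s : ℝ => s / (6 * (1 + s ^ 2) ^ 3)
        + 5 / 6 * (s * (3 * s ^ 2 + 5) / (8 * (1 + s ^ 2) ^ 2) + 3 / 8 * Real.arctan s))
      (1 / (1 + t ^ 2) ^ 4) t := by
  have hD : (1 + t ^ 2) ≠ 0 := by positivity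
  have hden : HasDerivAt (fun s : ℝ => 6 * (1 + s ^ 2) ^ 3) (6 * (3 * (1 + t ^ 2) ^ 2 * (2 * t))) t := by
    have := ((hasDerivAt_one_add_sq t).pow 3).const_mul 6
    refine this.congr_deriv ?_
    rfl
  have h1 := (hasDerivAt_id' t).div hden (by positivity)
  have h2 := (hasDerivAt_prim3 t).const_mul (5 / 6)
  refine (h1.add h2).congr_deriv ?_
  field_simp
  ring

/-- `P₂(t) → π/4` as `t → +∞`. [folklore] -/
private theorem tendsto_prim2 :
    Tendsto (fun s : ℝ => s / (2 * (1 + s ^ 2)) + 1 / 2 * Real.arctan s) atTop (𝓝 (π / 4)) := by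
  have h1 : Tendsto (fun s : ℝ => s / (2 * (1 + s ^ 2))) atTop (𝓝 0) := by
    have := tendsto_div_one_add_sq.const_mul (1 / 2)
    rw [mul_zero] at this
    refine this.congr fun s => ?_
    have : (1 + s ^ 2) ≠ 0 := by positivity
    field_simp
  have h2 : Tendsto (fun s : ℝ => 1 / 2 * Real.arctan s) atTop (𝓝 (1 / 2 * (π / 2))) :=
    (Real.tendsto_arctan_atTop.mono_right nhdsWithin_le_nhds).const_mul (1 / 2)
  have := h1.add h2
  convert this using 2
  ring

/-- `P₃(t) → 3π/16` as `t → +∞`. [folklore] -/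
private theorem tendsto_prim3 :
    Tendsto (fun s : ℝ => s * (3 * s ^ 2 + 5) / (8 * (1 + s ^ 2) ^ 2) + 3 / 8 * Real.arctan s) atTop
      (𝓝 (3 * π / 16)) := by
  -- `s(3s²+5)/(8(1+s²)²) = (s/(1+s²)) · ((3 + 2/(1+s²))/8) → 0 · (3/8) = 0`
  have h1 : Tendsto (fun s : ℝ => s * (3 * s ^ 2 + 5) / (8 * (1 + s ^ 2) ^ 2)) atTop (𝓝 0) := by
    have hb : Tendsto (fun s : ℝ => (3 + 2 * (1 + s ^ 2)⁻¹) / 8) atTop (𝓝 ((3 + 2 * 0) / 8)) :=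
      ((tendsto_inv_one_add_sq.const_mul 2).const_add 3).div_const 8
    have := tendsto_div_one_add_sq.mul hb
    rw [zero_mul] at this
    refine this.congr fun s => ?_
    have : (1 + s ^ 2) ≠ 0 := by positivity
    field_simp
    ring
  have h2 : Tendsto (fun s : ℝ => 3 / 8 * Real.arctan s) atTop (𝓝 (3 / 8 * (π / 2))) :=
    (Real.tendsto_arctan_atTop.mono_right nhdsWithin_le_nhds).const_mul (3 / 8)
  have := h1.add h2
  convert this using 2
  ring

/-- `P₄(t) → 5π/32` as `t → +∞`. [folklore] -/
private theorem tendsto_prim4 :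
    Tendsto (fun s : ℝ => s / (6 * (1 + s ^ 2) ^ 3)
        + 5 / 6 * (s * (3 * s ^ 2 + 5) / (8 * (1 + s ^ 2) ^ 2) + 3 / 8 * Real.arctan s)) atTop
      (𝓝 (5 * π / 32)) := by
  have h1 : Tendsto (fun s : ℝ => s / (6 * (1 + s ^ 2) ^ 3)) atTop (𝓝 0) := by
    have hb : Tendsto (fun s : ℝ => (1 + s ^ 2)⁻¹ ^ 2 / 6) atTop (𝓝 (0 ^ 2 / 6)) :=
      (tendsto_inv_one_add_sq.pow 2).div_const 6
    have := tendsto_div_one_add_sq.mul hb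
    rw [zero_mul] at this
    refine this.congr fun s => ?_
    have : (1 + s ^ 2) ≠ 0 := by positivity
    field_simp
  have h2 := tendsto_prim3.const_mul (5 / 6)
  have := h1.add h2
  convert this using 2
  ring

/-- `∫_{t>0} dt/(1+t²)² = π/4`, with integrability. [folklore] -/
theorem integral_Ioi_inv_one_add_sq_pow_two :
    IntegrableOn (fun t : ℝ => 1 / (1 + t ^ 2) ^ 2) (Ioi 0) ∧ ∫ t in Ioi (0 : ℝ), 1 / (1 + t ^ 2) ^ 2 = π / 4 := by
  have hpos : ∀ t ∈ Ioi (0 : ℝ), 0 ≤ 1 / (1 + t ^ 2) ^ 2 := fun t _ => by positivity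
  refine ⟨integrableOn_Ioi_deriv_of_nonneg' (fun t _ => hasDerivAt_prim2 t) hpos tendsto_prim2, ?_⟩
  rw [integral_Ioi_of_hasDerivAt_of_nonneg' (fun t _ => hasDerivAt_prim2 t) hpos tendsto_prim2]
  simp

/-- `∫_{t>0} dt/(1+t²)³ = 3π/16`, with integrability. [folklore] -/
theorem integral_Ioi_inv_one_add_sq_pow_three :
    IntegrableOn (fun t : ℝ => 1 / (1 + t ^ 2) ^ 3) (Ioi 0) ∧ ∫ t in Ioi (0 : ℝ), 1 / (1 + t ^ 2) ^ 3 = 3 * π / 16 := by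
  have hpos : ∀ t ∈ Ioi (0 : ℝ), 0 ≤ 1 / (1 + t ^ 2) ^ 3 := fun t _ => by positivity
  refine ⟨integrableOn_Ioi_deriv_of_nonneg' (fun t _ => hasDerivAt_prim3 t) hpos tendsto_prim3, ?_⟩
  rw [integral_Ioi_of_hasDerivAt_of_nonneg' (fun t _ => hasDerivAt_prim3 t) hpos tendsto_prim3]
  simp

/-- `∫_{t>0} dt/(1+t²)⁴ = 5π/32`, with integrability. [folklore] -/
theorem integral_Ioi_inv_one_add_sq_pow_four :
    IntegrableOn (fun t : ℝ => 1 / (1 + t ^ 2) ^ 4) (Ioi 0) ∧ ∫ t in Ioi (0 : ℝ), 1 / (1 + t ^ 2) ^ 4 = 5 * π / 32 := by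
  have hpos : ∀ t ∈ Ioi (0 : ℝ), 0 ≤ 1 / (1 + t ^ 2) ^ 4 := fun t _ => by positivity
  refine ⟨integrableOn_Ioi_deriv_of_nonneg' (fun t _ => hasDerivAt_prim4 t) hpos tendsto_prim4, ?_⟩
  rw [integral_Ioi_of_hasDerivAt_of_nonneg' (fun t _ => hasDerivAt_prim4 t) hpos tendsto_prim4]
  simp

/-- The integral of a combination `α/(1+t²)² + β/(1+t²)³ + γ/(1+t²)⁴` on `(0, ∞)`. [folklore] -/
theorem integral_Ioi_comb (α β γ : ℝ) :
    ∫ t in Ioi (0 : ℝ), (α * (1 / (1 + t ^ 2) ^ 2) + (β * (1 / (1 + t ^ 2) ^ 3) + γ * (1 / (1 + t ^ 2) ^ 4)))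
      = α * (π / 4) + (β * (3 * π / 16) + γ * (5 * π / 32)) := by
  obtain ⟨i2, v2⟩ := integral_Ioi_inv_one_add_sq_pow_two
  obtain ⟨i3, v3⟩ := integral_Ioi_inv_one_add_sq_pow_three
  obtain ⟨i4, v4⟩ := integral_Ioi_inv_one_add_sq_pow_four
  have hA : IntegrableOn (fun t : ℝ => α * (1 / (1 + t ^ 2) ^ 2)) (Ioi 0) := i2.const_mul α
  have hB : IntegrableOn (fun t : ℝ => β * (1 / (1 + t ^ 2) ^ 3)) (Ioi 0) := i3.const_mul β
  have hC : IntegrableOn (fun t : ℝ => γ * (1 / (1 + t ^ 2) ^ 4)) (Ioi 0) := i4.const_mul γ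
  have hBC : IntegrableOn (fun t : ℝ => β * (1 / (1 + t ^ 2) ^ 3) + γ * (1 / (1 + t ^ 2) ^ 4)) (Ioi 0) := hB.add hC
  rw [integral_add hA hBC, integral_add hB hC, integral_const_mul, integral_const_mul, integral_const_mul, v2, v3, v4]


/-! ### Decay and integrability of the double-pole profile's derivative -/

/-- `profile t = t/(1+t²)² → 0` at `+∞`. [folklore] -/
private theorem tendsto_profile_atTop : Tendsto profile atTop (𝓝 0) := by
  have := tendsto_div_one_add_sq.mul tendsto_inv_one_add_sq
  rw [zero_mul] at this
  refine this.congr fun s => ?_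
  unfold profile
  have : (1 + s ^ 2) ≠ 0 := by positivity
  field_simp

/-- `f′ = dProfile` is continuous. [folklore] -/
private theorem continuous_dProfile : Continuous dProfile := by
  unfold dProfile
  exact Continuous.div (by fun_prop) (by fun_prop) (fun t => by positivity)

/-- `f′` is integrable on `(0, ∞)` (dominated by `3/(1+t²)²`) and `∫_{t>0} f′ = −f(0) = 0`. [folklore] -/
theorem integral_Ioi_dProfile : IntegrableOn dProfile (Ioi 0) ∧ ∫ t in Ioi (0 : ℝ), dProfile t = 0 := by
  obtain ⟨i2, -⟩ := integral_Ioi_inv_one_add_sq_pow_two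
  have hint : IntegrableOn dProfile (Ioi 0) := by
    refine Integrable.mono' (i2.const_mul 3) continuous_dProfile.aestronglyMeasurable (Eventually.of_forall fun t => ?_)
    rw [Real.norm_eq_abs]
    unfold dProfile
    have hD : 0 < 1 + t ^ 2 := by positivity
    rw [abs_div, abs_of_pos (pow_pos hD 3), div_le_iff₀ (pow_pos hD 3)]
    have h3 : |1 - 3 * t ^ 2| ≤ 3 * (1 + t ^ 2) := by
      rw [abs_le]; constructor <;> nlinarith [sq_nonneg t]
    calc |1 - 3 * t ^ 2| ≤ 3 * (1 + t ^ 2) := h3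
      _ = 3 * (1 / (1 + t ^ 2) ^ 2) * (1 + t ^ 2) ^ 3 := by field_simp
  refine ⟨hint, ?_⟩
  rw [integral_Ioi_of_hasDerivAt_of_tendsto' (fun t _ => hasDerivAt_profile t) hint tendsto_profile_atTop]
  simp [profile]

end GCLMGaugeAOriginRates
end Summit.NavierStokesRegularity.OSWSelfSimilar
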